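import Summits.CriticalPhenomena.PercolationContinuityZ3.Theorems.PercNearOneGluingAdditiveGluingOffClusterFunctional
import Summits.CriticalPhenomena.PercolationContinuityZ3.Theorems.PercNearOneGluingNoHeavyLowerTailEventGluingSharp
import Summits.CriticalPhenomena.PercolationContinuityZ3.Theorems.PercNearOneGluingAdditiveGluingBhkMenu
import HarnessLib

/-!
# Crux `PercNearOneGluing.AdditiveGluing` (stmt-CriticalPhenomena-4576), line `tieline`: the set-gluing kernel (K₀-set) —
# registered stub `stub_k0set3_g2` — PROVED, and the SPLIT inequality

Support file (`--supports stmt-CriticalPhenomena-4576`; seat (d) exchange-certificate form, gen 33).  No definitions, no named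
facts, no sorries.

Weighted graph on `Fin n` (`μ = prodBernoulli w`), target `b`, relay set `S` with `τ`-minimiser `s₀` (`τ_x = μ(x ↔ b)`), spectator
`c ∉ S`, observer `o`; `x ↔ S = ⋃_{s ∈ S} {x ↔ s}`, `N = {c ↮ S}`, `NJ = N ∩ {o ↔ c}`,
`Ψ(x) = μ(S ↔ b) − τ_{s₀} − μ(x ↮ b ∩ x ↔ S ∩ S ↔ b)`.  The stub: `μ(NJ)·Ψ(c) ≤ μ(N)·Ψ(o)`.

## Proof (memo `run/shared/lean/prim/prim-png-dp-exchcert/EXCHCERT-g33.md`)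

With the off-cluster disconnection functional `F` of `…OffClusterFunctional.lean` (`m_a = ∫ F(C(a)) = τ_a + μ(b ↮ S)`), a
`τ`-compatible injective rank `r` (`AGloc.exists_rank_compat`), the first-in-rank patterns `P^x_a = {x ↔ a} ∩ ⋂_{r a' < r a} {x ↮ a'}`
and the ranked surplus `Sur_x = CSH.surplus w S r F x`, one has the IDENTITY
`Ψ(x) = Sur_x + (μ(S ↔ b) − τ_{s₀})·μ(x ↮ S) + Σ_a μ(P^x_a)(τ_a − τ_{s₀})`.  Each summand transfers from `c` to `o`:
* `Sur` by (S5) of the tree (`surplusTransfer_holds` = `CSH.surplusTransfer_of_nondegenerate` ∘ `…_of_s5dMargin` ∘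
  `s5dMargin_nonneg_of_csh` ∘ `cshAll`, composed exactly as in `EventGluingSharp.gen_holds`);
* `μ(· ↮ S)` by the inclusion `{c ↮ S} ∩ {o ↔ c} ⊆ {o ↮ S}`;
* each pattern by BHK 2006 Thm. 1.3 for the cluster of `c` given `{c ↮ S_{<a}}` (`firstRank_transfer`: `{c ↔ o}`, `{c ↔ a}` are
  positively correlated, `{c ↔ o}`, `{c ↮ S}` negatively), with the nonnegative weights `τ_a − τ_{s₀}`.
(GEN) (`EventGluingSharp.gen_holds`) for the same functional is the SPLIT inequality `μ(x ↮ b ∩ x ↔ S ∩ S ↔ b) ≤ μ(x ↔ S)(μ(S ↔ b) − τ_{s₀})`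
(`K0Set3.split`).  Finally `stub_k0set3_g2` (verbatim signature); the tieline composition of the crux is then the term
`additiveGluing_of_k0set3 stub_k0set3_g2 : AdditiveGluing` (not restated here: the crux is already closed by `Theorems.AdditiveGluing_proof`).
[cite: KozmaNitzan2024, Lemma 4 (p. 9), §5.3 (p. 34), Question 7 (p. 36), Conj. 4 (p. 32)]
[cite: VandenbergHaggstromKahn2005, Thm. 1.3 (p. 6), §1 pp. 7–8 display (10)]
-/

namespace Summit.CriticalPhenomena.PercolationContinuityZ3.Cruxes.AdditiveGluing.TieLine

open MeasureTheory Set Literature.Probability.LatticeModels Literature.Probability.Percolation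
open Summit.CriticalPhenomena.PercolationContinuityZ3.Theorems

noncomputable section
open Classical

namespace K0Set3

open OffCluster

variable {n : ℕ}

/-! ### (S5) of the tree, packaged -/

/-- **(S5), the surplus transfer, on every finite weighted graph** (the tree's chain, as composed in `EventGluingSharp.gen_holds`):
for `v ∉ T`, a monotone `F` and an injective `∫F(C(·))`-compatible rank,
`μ({v ↮ T} ∩ {o ↔ v})·Sur_v(T) ≤ μ(v ↮ T)·Sur_o(T)`. [cite: KozmaNitzan2024, Conj. 4 (p. 32)] -/
theorem surplusTransfer_holds (w : Sym2 (Fin n) → unitInterval) (T : Finset (Fin n)) (o v : Fin n)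
    (F : Set (Fin n) → ℝ) (r : Fin n → ℕ) (hvT : v ∉ T) (hF : ∀ S S' : Set (Fin n), S ⊆ S' → F S ≤ F S')
    (hr : Set.InjOn r ↑T)
    (hcompat : ∀ a ∈ T, ∀ a' ∈ T, r a < r a' →
      ∫ ω, F (openCluster ω a) ∂(prodBernoulli w) ≤ ∫ ω, F (openCluster ω a') ∂(prodBernoulli w)) :
    (prodBernoulli w).real ({ω : BondConfig (Fin n) | ∀ a ∈ T, ¬ (openGraph ω).Reachable v a} ∩ openConn o v) *
        CSH.surplus w T r F v ≤
      (prodBernoulli w).real {ω : BondConfig (Fin n) | ∀ a ∈ T, ¬ (openGraph ω).Reachable v a} * CSH.surplus w T r F o :=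
  CSH.surplusTransfer_of_nondegenerate T o v F
    (fun p hp r' hr' hc' =>
      CSH.surplusTransfer_nondegenerate_of_s5dMargin p hp T o v F r' hvT hr' hc' fun hoT hov =>
        CSH.s5dMargin_nonneg_of_csh p hp o v (fun x Y D => CSH.cshAll n p hp o v x Y D hov) T r' [] F hF hr' hc'
          hoT hvT List.nodup_nil (fun _ hd => absurd hd List.not_mem_nil))
    w r hr hcompat

/-! ### The first-in-rank attachment transfer (BHK 2006, Thm. 1.3 for the cluster of the spectator) -/

/-- Point literal of the cluster of `c`: `{C | c ↔ y in C}` evaluated at `C_c(ω)` is `1{c ↔ y}(ω)`. [folklore] -/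
theorem ptIndicator_apply (c y : Fin n) (ω : BondConfig (Fin n)) :
    {C : Set (Sym2 (Fin n)) | (openGraph C).Reachable c y}.indicator (1 : Set (Sym2 (Fin n)) → ℝ) (openEdgeCluster ω c) =
      (openConn c y : Set (BondConfig (Fin n))).indicator 1 ω := by
  by_cases h : (openGraph ω).Reachable c y
  · rw [indicator_of_mem (show openEdgeCluster ω c ∈ {C : Set (Sym2 (Fin n)) | (openGraph C).Reachable c y} from
        knThm2_reachable_openEdgeCluster h), indicator_of_mem (show ω ∈ (openConn c y : Set (BondConfig (Fin n))) from h)]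
    rfl
  · rw [indicator_of_notMem (show openEdgeCluster ω c ∉ {C : Set (Sym2 (Fin n)) | (openGraph C).Reachable c y} from
        fun h' => h (h'.mono (openGraph_mono (openEdgeCluster_subset ω c)))),
      indicator_of_notMem (show ω ∉ (openConn c y : Set (BondConfig (Fin n))) from h)]

/-- Avoidance literal of the cluster of `c`: `{C | ∀ a ∈ S, c ↮ a in C}` evaluated at `C_c(ω)` is `1{c ↮ S}(ω)`. [folklore] -/
theorem avoidIndicator_apply (S : Finset (Fin n)) (c : Fin n) (ω : BondConfig (Fin n)) :
    {C : Set (Sym2 (Fin n)) | ∀ a ∈ S, ¬ (openGraph C).Reachable c a}.indicator (1 : Set (Sym2 (Fin n)) → ℝ)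
        (openEdgeCluster ω c) =
      ({ω : BondConfig (Fin n) | ∀ a ∈ S, ¬ (openGraph ω).Reachable c a}).indicator 1 ω := by
  by_cases h : ∀ a ∈ S, ¬ (openGraph ω).Reachable c a
  · rw [indicator_of_mem (show openEdgeCluster ω c ∈ {C : Set (Sym2 (Fin n)) | ∀ a ∈ S, ¬ (openGraph C).Reachable c a} from
        fun a ha h' => h a ha (h'.mono (openGraph_mono (openEdgeCluster_subset ω c)))),
      indicator_of_mem (show ω ∈ {ω : BondConfig (Fin n) | ∀ a ∈ S, ¬ (openGraph ω).Reachable c a} from h)]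
    rfl
  · rw [indicator_of_notMem (show openEdgeCluster ω c ∉ {C : Set (Sym2 (Fin n)) | ∀ a ∈ S, ¬ (openGraph C).Reachable c a} from
        fun h' => h fun a ha hr => h' a ha (knThm2_reachable_openEdgeCluster hr)),
      indicator_of_notMem (show ω ∉ {ω : BondConfig (Fin n) | ∀ a ∈ S, ¬ (openGraph ω).Reachable c a} from h)]

/-- **First-in-rank attachment transfer.**  For `c ∉ S`, any `s` and the set `X = {s' ∈ S | r s' < r s}` of lower-ranked relays:
`μ({c ↮ S} ∩ {o ↔ c})·μ({c ↔ s} ∩ {c ↮ X}) ≤ μ(c ↮ S)·μ({o ↔ s} ∩ {o ↮ X})`.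
Proof: BHK Thm. 1.3 for the cluster of `c` given `{c ↮ X}` — `{c ↔ o}`, `{c ↔ s}` are positively correlated, `{c ↔ o}`,
`{c ↮ S}` negatively — and `{c ↮ X} ∩ {c ↔ o} ∩ {c ↔ s} ⊆ {o ↔ s} ∩ {o ↮ X}`.
[cite: VandenbergHaggstromKahn2005, Thm. 1.3 (p. 6)] -/
theorem firstRank_transfer (w : Sym2 (Fin n) → unitInterval) (S : Finset (Fin n)) (r : Fin n → ℕ) (o c s : Fin n)
    (hcS : c ∉ S) :
    (prodBernoulli w).real ({ω : BondConfig (Fin n) | ∀ a ∈ S, ¬ (openGraph ω).Reachable c a} ∩ openConn o c) *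
        (prodBernoulli w).real
          (openConn c s ∩ ⋂ a' ∈ S.filter (fun a' => r a' < r s), (openConn c a')ᶜ : Set (BondConfig (Fin n))) ≤
      (prodBernoulli w).real {ω : BondConfig (Fin n) | ∀ a ∈ S, ¬ (openGraph ω).Reachable c a} *
        (prodBernoulli w).real
          (openConn o s ∩ ⋂ a' ∈ S.filter (fun a' => r a' < r s), (openConn o a')ᶜ : Set (BondConfig (Fin n))) := by
  set μ := prodBernoulli w with hμ
  set X : Set (Fin n) := {a | a ∈ S.filter (fun a' => r a' < r s)} with hX
  set D : Set (BondConfig (Fin n)) := {ω | ∀ x ∈ X, ¬ (openGraph ω).Reachable c x} with hD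
  set N : Set (BondConfig (Fin n)) := {ω | ∀ a ∈ S, ¬ (openGraph ω).Reachable c a} with hN
  set J : Set (BondConfig (Fin n)) := openConn c o with hJ
  set B : Set (BondConfig (Fin n)) := openConn c s with hB
  have hcX : c ∉ X := fun h => hcS (Finset.mem_filter.1 h).1
  have hND : N ⊆ D := fun ω hω x hx => hω x (Finset.mem_filter.1 hx).1
  -- the up-sets / down-set of edge sets and their indicators
  have hJm : Monotone ({C : Set (Sym2 (Fin n)) | (openGraph C).Reachable c o}.indicator (1 : Set (Sym2 (Fin n)) → ℝ)) :=
    bhkMenu_monotone_indicator (bhkMenu_pt_isUpperSet c o)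
  have hBm : Monotone ({C : Set (Sym2 (Fin n)) | (openGraph C).Reachable c s}.indicator (1 : Set (Sym2 (Fin n)) → ℝ)) :=
    bhkMenu_monotone_indicator (bhkMenu_pt_isUpperSet c s)
  have hEa : Antitone ({C : Set (Sym2 (Fin n)) | ∀ a ∈ S, ¬ (openGraph C).Reachable c a}.indicator
      (1 : Set (Sym2 (Fin n)) → ℝ)) := by
    intro C C' hCC'
    by_cases h : C' ∈ {C : Set (Sym2 (Fin n)) | ∀ a ∈ S, ¬ (openGraph C).Reachable c a}
    · have h' : C ∈ {C : Set (Sym2 (Fin n)) | ∀ a ∈ S, ¬ (openGraph C).Reachable c a} :=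
        fun a ha hr => h a ha (hr.mono (openGraph_mono hCC'))
      rw [indicator_of_mem h, indicator_of_mem h', Pi.one_apply, Pi.one_apply]
    · rw [indicator_of_notMem h]
      exact indicator_nonneg (fun _ _ => zero_le_one) _
  -- (A) positive association of `{c ↔ o}` and `{c ↔ s}` given `{c ↮ X}`
  have keyA := BHK2006_clusterConditionalPositiveAssociation_holds (Fin n) w c X _ _ hJm hBm hcX
  -- (B) negative correlation of `{c ↔ o}` and `{c ↮ S}` given `{c ↮ X}`
  have keyB := BHK2006_clusterConditionalPositiveAssociation.antitone_right
    BHK2006_clusterConditionalPositiveAssociation_holds (Fin n) w c X _ _ hJm hEa hcX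
  simp only [ptIndicator_apply, avoidIndicator_apply] at keyA keyB
  have h1 := knThm2_setIntegral_indicator w D J B
  have h2 := knThm2_setIntegral_indicator w D B B
  have h3 := knThm2_setIntegral_indicator w D J N
  have h4 := knThm2_setIntegral_indicator w D N N
  rw [← hμ, ← hD] at keyA keyB
  rw [h1.1, h2.1, h1.2] at keyA
  rw [h3.2, h1.1, h4.1] at keyB
  -- bookkeeping of the events
  have hDN : D ∩ N = N := inter_eq_right.2 hND
  have hDJN : D ∩ (J ∩ N) = N ∩ openConn o c := by
    ext ω
    constructor
    · rintro ⟨-, hj, hn⟩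
      exact ⟨hn, SimpleGraph.Reachable.symm hj⟩
    · rintro ⟨hn, hj⟩
      exact ⟨hND hn, SimpleGraph.Reachable.symm hj, hn⟩
  have hPc : (openConn c s ∩ ⋂ a' ∈ S.filter (fun a' => r a' < r s), (openConn c a')ᶜ : Set (BondConfig (Fin n))) = D ∩ B := by
    ext ω
    simp only [mem_inter_iff, mem_iInter, mem_compl_iff, hD, hX, mem_setOf_eq]
    constructor
    · rintro ⟨hb, h⟩
      exact ⟨fun x hx => h x hx, hb⟩
    · rintro ⟨h, hb⟩
      exact ⟨hb, fun x hx => h x hx⟩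
  have hPo : D ∩ (J ∩ B) ⊆ (openConn o s ∩ ⋂ a' ∈ S.filter (fun a' => r a' < r s), (openConn o a')ᶜ :
      Set (BondConfig (Fin n))) := by
    intro ω hω
    obtain ⟨hd, hj, hb⟩ := hω
    simp only [mem_inter_iff, mem_iInter, mem_compl_iff]
    refine ⟨SimpleGraph.Reachable.trans (SimpleGraph.Reachable.symm hj) hb, fun x hx hox => ?_⟩
    exact hd x hx (SimpleGraph.Reachable.trans hj hox)
  rw [hDN, hDJN] at keyB
  rw [hPc]
  -- the algebra: `j·q ≤ d·k`, `d·NJ ≤ j·N`, `k ≤ po` ⟹ `NJ·q ≤ N·po`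
  have hk : μ.real (D ∩ (J ∩ B)) ≤ μ.real
      (openConn o s ∩ ⋂ a' ∈ S.filter (fun a' => r a' < r s), (openConn o a')ᶜ : Set (BondConfig (Fin n))) :=
    measureReal_mono hPo
  have hNJj : μ.real (N ∩ openConn o c) ≤ μ.real (D ∩ J) :=
    measureReal_mono fun ω hω => ⟨hND hω.1, SimpleGraph.Reachable.symm hω.2⟩
  have h0 : ∀ A : Set (BondConfig (Fin n)), 0 ≤ μ.real A := fun _ => measureReal_nonneg
  rcases (h0 (D ∩ J)).eq_or_lt with hj0 | hjpos
  · have hNJ0 : μ.real (N ∩ openConn o c) = 0 := le_antisymm (hj0 ▸ hNJj) (h0 _)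
    rw [hNJ0, zero_mul]
    exact mul_nonneg (h0 _) (h0 _)
  · have hchain : μ.real (D ∩ J) * (μ.real (N ∩ openConn o c) * μ.real (D ∩ B)) ≤
        μ.real (D ∩ J) * (μ.real N * μ.real (D ∩ (J ∩ B))) :=
      calc μ.real (D ∩ J) * (μ.real (N ∩ openConn o c) * μ.real (D ∩ B))
          = (μ.real (D ∩ J) * μ.real (D ∩ B)) * μ.real (N ∩ openConn o c) := by ring
        _ ≤ (μ.real D * μ.real (D ∩ (J ∩ B))) * μ.real (N ∩ openConn o c) :=
            mul_le_mul_of_nonneg_right keyA (h0 _)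
        _ = μ.real (D ∩ (J ∩ B)) * (μ.real D * μ.real (N ∩ openConn o c)) := by ring
        _ ≤ μ.real (D ∩ (J ∩ B)) * (μ.real (D ∩ J) * μ.real N) :=
            mul_le_mul_of_nonneg_left keyB (h0 _)
        _ = μ.real (D ∩ J) * (μ.real N * μ.real (D ∩ (J ∩ B))) := by ring
    have h5 := le_of_mul_le_mul_left hchain hjpos
    calc μ.real (N ∩ openConn o c) * μ.real (D ∩ B)
        ≤ μ.real N * μ.real (D ∩ (J ∩ B)) := h5
      _ ≤ _ := mul_le_mul_of_nonneg_left hk (h0 _)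

/-! ### Assembly -/

/-- **(K₀-set), assembled** (general form: any relay set `S`, `s₀ ∈ S` a `τ`-minimiser, `c ∉ S`):
`μ({c ↮ S} ∩ {o ↔ c})·Ψ(c) ≤ μ(c ↮ S)·Ψ(o)`, `Ψ(x) = μ(S ↔ b) − τ_{s₀} − μ(x ↮ b ∩ x ↔ S ∩ S ↔ b)`.
[cite: KozmaNitzan2024, Lemma 4 (p. 9), Question 7 (p. 36), Conj. 4 (p. 32)] [cite: VandenbergHaggstromKahn2005, Thm. 1.3 (p. 6)] -/
theorem k0set (w : Sym2 (Fin n) → unitInterval) (S : Finset (Fin n)) (o b c s₀ : Fin n) (hs₀ : s₀ ∈ S) (hcS : c ∉ S)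
    (hmin : ∀ s ∈ S, (prodBernoulli w).real (openConn s₀ b) ≤ (prodBernoulli w).real (openConn s b)) :
    (prodBernoulli w).real ((⋃ s ∈ S, (openConn c s : Set (BondConfig (Fin n))))ᶜ ∩ openConn o c) *
        ((prodBernoulli w).real (⋃ s ∈ S, (openConn s b : Set (BondConfig (Fin n)))) -
          (prodBernoulli w).real (openConn s₀ b) -
          (prodBernoulli w).real ((openConn c b)ᶜ ∩ (⋃ s ∈ S, (openConn c s : Set (BondConfig (Fin n)))) ∩
            (⋃ s ∈ S, (openConn s b : Set (BondConfig (Fin n)))))) ≤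
      (prodBernoulli w).real ((⋃ s ∈ S, (openConn c s : Set (BondConfig (Fin n))))ᶜ) *
        ((prodBernoulli w).real (⋃ s ∈ S, (openConn s b : Set (BondConfig (Fin n)))) -
          (prodBernoulli w).real (openConn s₀ b) -
          (prodBernoulli w).real ((openConn o b)ᶜ ∩ (⋃ s ∈ S, (openConn o s : Set (BondConfig (Fin n)))) ∩
            (⋃ s ∈ S, (openConn s b : Set (BondConfig (Fin n)))))) := by
  set μ := prodBernoulli w with hμ
  have hmeas : ∀ A : Set (BondConfig (Fin n)), MeasurableSet A := fun _ => MeasurableSet.of_discrete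
  have h0 : ∀ A : Set (BondConfig (Fin n)), 0 ≤ μ.real A := fun _ => measureReal_nonneg
  -- events
  set BS : Set (BondConfig (Fin n)) := ⋃ s ∈ S, (openConn s b : Set (BondConfig (Fin n))) with hBS
  set Nset : Set (BondConfig (Fin n)) := {ω | ∀ a ∈ S, ¬ (openGraph ω).Reachable c a} with hNset
  set Q : Set (BondConfig (Fin n)) := {ω | ∀ s ∈ S, ¬ (openGraph ω).Reachable b s} with hQ
  have hN : (⋃ s ∈ S, (openConn c s : Set (BondConfig (Fin n))))ᶜ = Nset := by
    ext ω; simp only [mem_compl_iff, mem_iUnion, mem_setOf_eq, exists_prop, not_exists, not_and, hNset]; rfl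
  have hQBS : Q = BSᶜ := by
    ext ω
    simp only [hQ, hBS, mem_compl_iff, mem_iUnion, mem_setOf_eq, exists_prop, not_exists, not_and]
    exact ⟨fun h s hs hsb => h s hs (SimpleGraph.Reachable.symm hsb), fun h s hs hbs => h s hs (SimpleGraph.Reachable.symm hbs)⟩
  have hQ1 : μ.real Q = 1 - μ.real BS := by rw [hQBS, probReal_compl_eq_one_sub (hmeas _)]
  -- the functional
  set F : Set (Fin n) → ℝ := fun K => if b ∈ K then (1 : ℝ) else μ.real
      {η : BondConfig (Fin n) | ∀ s ∈ S, s ∉ K → ¬ (openGraph (η \ {e : Sym2 (Fin n) | ∃ v ∈ e, v ∈ K})).Reachable b s}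
    with hFdef
  have hF : ∀ K, F K = if b ∈ K then (1 : ℝ) else μ.real
      {η : BondConfig (Fin n) | ∀ s ∈ S, s ∉ K → ¬ (openGraph (η \ {e : Sym2 (Fin n) | ∃ v ∈ e, v ∈ K})).Reachable b s} :=
    fun K => rfl
  have hmean := integral_offF_relay w S b F hF
  rw [← hμ] at hmean
  -- a reliability-compatible injective rank
  obtain ⟨r, hr, hrc⟩ := AGloc.exists_rank_compat S (fun a => μ.real (openConn a b))
  have hcompat : ∀ a ∈ S, ∀ a' ∈ S, r a < r a' →
      ∫ ω, F (openCluster ω a) ∂μ ≤ ∫ ω, F (openCluster ω a') ∂μ := by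
    intro a ha a' ha' hlt
    rw [hmean a ha, hmean a' ha']
    exact add_le_add (hrc a ha a' ha' hlt) le_rfl
  -- (S5)
  have hS5 := surplusTransfer_holds w S o c F r hcS (offF_mono w S b F hF) hr hcompat
  rw [← hμ, ← hNset] at hS5
  -- evaluation of the surplus
  set po : Fin n → Fin n → ℝ := fun u a => μ.real
    (openConn u a ∩ ⋂ a' ∈ S.filter (fun a' => r a' < r a), (openConn u a')ᶜ : Set (BondConfig (Fin n))) with hpo
  have hsur : ∀ u : Fin n, CSH.surplus w S r F u =
      μ.real ((⋃ s ∈ S, (openConn u s : Set (BondConfig (Fin n)))) ∩ openConn u b) +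
        μ.real ((⋃ s ∈ S, (openConn u s : Set (BondConfig (Fin n)))) ∩ Q) -
        (∑ a ∈ S, po u a * μ.real (openConn a b) + μ.real Q * μ.real (⋃ s ∈ S, (openConn u s : Set (BondConfig (Fin n))))) := by
    intro u
    have key := setIntegral_offF_reach w S b F hF u
    rw [← hμ] at key
    have hsum : ∑ a ∈ S, po u a * ∫ ω, F (openCluster ω a) ∂μ =
        ∑ a ∈ S, po u a * μ.real (openConn a b) + μ.real Q * μ.real (⋃ s ∈ S, (openConn u s : Set (BondConfig (Fin n)))) := by
      rw [← AGloc.sum_measureReal_firstRank w S r u hr, ← hμ, Finset.mul_sum, ← Finset.sum_add_distrib]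
      refine Finset.sum_congr rfl fun a ha => ?_
      rw [hmean a ha]; ring
    unfold CSH.surplus
    rw [← hμ, key, hsum]
  have hpart := measureReal_reach_partition w S b
  rw [← hμ] at hpart
  -- the three transfers
  have hNUm : 0 ≤ (μ.real BS - μ.real (openConn s₀ b)) *
      (μ.real Nset * (1 - μ.real (⋃ s ∈ S, (openConn o s : Set (BondConfig (Fin n))))) -
        μ.real (Nset ∩ openConn o c) * (1 - μ.real (⋃ s ∈ S, (openConn c s : Set (BondConfig (Fin n)))))) := by
    have hM : μ.real (openConn s₀ b) ≤ μ.real BS := by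
      refine measureReal_mono (fun ω hω => ?_) (measure_ne_top _ _)
      simpa only [hBS, mem_iUnion, exists_prop] using ⟨s₀, hs₀, hω⟩
    have hNc : μ.real Nset = 1 - μ.real (⋃ s ∈ S, (openConn c s : Set (BondConfig (Fin n)))) := by
      rw [← hN, probReal_compl_eq_one_sub (hmeas _)]
    have hNJ : μ.real (Nset ∩ openConn o c) ≤ 1 - μ.real (⋃ s ∈ S, (openConn o s : Set (BondConfig (Fin n)))) := by
      rw [← probReal_compl_eq_one_sub (hmeas _)]
      refine measureReal_mono (fun ω hω => ?_) (measure_ne_top _ _)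
      simp only [mem_compl_iff, mem_iUnion, exists_prop, not_exists, not_and]
      intro s hs hos
      exact hω.1 s hs (SimpleGraph.Reachable.trans (SimpleGraph.Reachable.symm hω.2) hos)
    refine mul_nonneg (sub_nonneg.2 hM) ?_
    rw [← hNc]
    nlinarith [h0 Nset, h0 (Nset ∩ openConn o c)]
  have hTX : 0 ≤ μ.real Nset *
        (∑ a ∈ S, po o a * μ.real (openConn a b) -
          μ.real (openConn s₀ b) * μ.real (⋃ s ∈ S, (openConn o s : Set (BondConfig (Fin n))))) -
      μ.real (Nset ∩ openConn o c) *
        (∑ a ∈ S, po c a * μ.real (openConn a b) -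
          μ.real (openConn s₀ b) * μ.real (⋃ s ∈ S, (openConn c s : Set (BondConfig (Fin n))))) := by
    have hterm : ∀ a ∈ S, 0 ≤ (μ.real (openConn a b) - μ.real (openConn s₀ b)) *
        (μ.real Nset * po o a - μ.real (Nset ∩ openConn o c) * po c a) := by
      intro a ha
      refine mul_nonneg (sub_nonneg.2 (hmin a ha)) (sub_nonneg.2 ?_)
      have key := firstRank_transfer w S r o c a hcS
      rw [← hμ] at key
      simpa only [hpo, mul_comm] using key
    have hsum := Finset.sum_nonneg hterm
    rw [← AGloc.sum_measureReal_firstRank w S r o hr, ← AGloc.sum_measureReal_firstRank w S r c hr, ← hμ]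
    have e : ∑ a ∈ S, (μ.real (openConn a b) - μ.real (openConn s₀ b)) *
          (μ.real Nset * po o a - μ.real (Nset ∩ openConn o c) * po c a) =
        μ.real Nset * (∑ a ∈ S, po o a * μ.real (openConn a b) - μ.real (openConn s₀ b) * ∑ a ∈ S, po o a) -
          μ.real (Nset ∩ openConn o c) *
            (∑ a ∈ S, po c a * μ.real (openConn a b) - μ.real (openConn s₀ b) * ∑ a ∈ S, po c a) := by
      rw [Finset.mul_sum, Finset.mul_sum, ← Finset.sum_sub_distrib, ← Finset.sum_sub_distrib, Finset.mul_sum, Finset.mul_sum,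
        ← Finset.sum_sub_distrib]
      refine Finset.sum_congr rfl fun a _ => ?_
      ring
    rw [e] at hsum
    exact hsum
  -- the identity `Ψ(u) = Sur_u + M·μ(u ↮ S) + X_u` for `u = o, c`, and assembly
  have ido : μ.real BS - μ.real (openConn s₀ b) -
        μ.real ((openConn o b)ᶜ ∩ (⋃ s ∈ S, (openConn o s : Set (BondConfig (Fin n)))) ∩ BS) =
      CSH.surplus w S r F o +
        (μ.real BS - μ.real (openConn s₀ b)) * (1 - μ.real (⋃ s ∈ S, (openConn o s : Set (BondConfig (Fin n))))) +
        (∑ a ∈ S, po o a * μ.real (openConn a b) -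
          μ.real (openConn s₀ b) * μ.real (⋃ s ∈ S, (openConn o s : Set (BondConfig (Fin n))))) := by
    linear_combination -(hsur o) + hpart o + μ.real (⋃ s ∈ S, (openConn o s : Set (BondConfig (Fin n)))) * hQ1
  have idc : μ.real BS - μ.real (openConn s₀ b) -
        μ.real ((openConn c b)ᶜ ∩ (⋃ s ∈ S, (openConn c s : Set (BondConfig (Fin n)))) ∩ BS) =
      CSH.surplus w S r F c +
        (μ.real BS - μ.real (openConn s₀ b)) * (1 - μ.real (⋃ s ∈ S, (openConn c s : Set (BondConfig (Fin n))))) +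
        (∑ a ∈ S, po c a * μ.real (openConn a b) -
          μ.real (openConn s₀ b) * μ.real (⋃ s ∈ S, (openConn c s : Set (BondConfig (Fin n))))) := by
    linear_combination -(hsur c) + hpart c + μ.real (⋃ s ∈ S, (openConn c s : Set (BondConfig (Fin n)))) * hQ1
  rw [hN, ido, idc]
  linear_combination hS5 + hNUm + hTX

/-- **The SPLIT inequality** (the split-attachment / τ-gap lemma of the tieline; `TAUS` is its instance `x = s₀'` for the relay
set): for a `τ`-minimiser `s₀ ∈ S` and every vertex `x`,
`μ(x ↮ b ∩ x ↔ S ∩ S ↔ b) ≤ μ(x ↔ S)·(μ(S ↔ b) − τ_{s₀})` (hence `≤ μ(S ↔ b) − τ_{s₀}`).  The tree's (GEN) (`EventGluingSharp.gen_holds`)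
for the off-cluster disconnection functional. [cite: KozmaNitzan2024, Conj. 4 (p. 32), Lemma 4 (p. 9)] -/
theorem split (w : Sym2 (Fin n) → unitInterval) (S : Finset (Fin n)) (x b s₀ : Fin n)
    (hmin : ∀ s ∈ S, (prodBernoulli w).real (openConn s₀ b) ≤ (prodBernoulli w).real (openConn s b)) :
    (prodBernoulli w).real ((openConn x b)ᶜ ∩ (⋃ s ∈ S, (openConn x s : Set (BondConfig (Fin n)))) ∩
        (⋃ s ∈ S, (openConn s b : Set (BondConfig (Fin n))))) ≤
      (prodBernoulli w).real (⋃ s ∈ S, (openConn x s : Set (BondConfig (Fin n)))) *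
        ((prodBernoulli w).real (⋃ s ∈ S, (openConn s b : Set (BondConfig (Fin n)))) - (prodBernoulli w).real (openConn s₀ b)) := by
  set μ := prodBernoulli w with hμ
  have hmeas : ∀ A : Set (BondConfig (Fin n)), MeasurableSet A := fun _ => MeasurableSet.of_discrete
  set BS : Set (BondConfig (Fin n)) := ⋃ s ∈ S, (openConn s b : Set (BondConfig (Fin n))) with hBS
  set Q : Set (BondConfig (Fin n)) := {ω | ∀ s ∈ S, ¬ (openGraph ω).Reachable b s} with hQ
  have hQBS : Q = BSᶜ := by
    ext ω
    simp only [hQ, hBS, mem_compl_iff, mem_iUnion, mem_setOf_eq, exists_prop, not_exists, not_and]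
    exact ⟨fun h s hs hsb => h s hs (SimpleGraph.Reachable.symm hsb), fun h s hs hbs => h s hs (SimpleGraph.Reachable.symm hbs)⟩
  have hQ1 : μ.real Q = 1 - μ.real BS := by rw [hQBS, probReal_compl_eq_one_sub (hmeas _)]
  set F : Set (Fin n) → ℝ := fun K => if b ∈ K then (1 : ℝ) else μ.real
      {η : BondConfig (Fin n) | ∀ s ∈ S, s ∉ K → ¬ (openGraph (η \ {e : Sym2 (Fin n) | ∃ v ∈ e, v ∈ K})).Reachable b s}
    with hFdef
  have hF : ∀ K, F K = if b ∈ K then (1 : ℝ) else μ.real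
      {η : BondConfig (Fin n) | ∀ s ∈ S, s ∉ K → ¬ (openGraph (η \ {e : Sym2 (Fin n) | ∃ v ∈ e, v ∈ K})).Reachable b s} :=
    fun K => rfl
  have hmean := integral_offF_relay w S b F hF
  rw [← hμ] at hmean
  obtain ⟨r, hr, hrc⟩ := AGloc.exists_rank_compat S (fun a => μ.real (openConn a b))
  have hcompat : ∀ a ∈ S, ∀ a' ∈ S, r a < r a' →
      ∫ ω, F (openCluster ω a) ∂μ ≤ ∫ ω, F (openCluster ω a') ∂μ := by
    intro a ha a' ha' hlt
    rw [hmean a ha, hmean a' ha']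
    exact add_le_add (hrc a ha a' ha' hlt) le_rfl
  have key := EventGluingSharp.gen_holds n w S x F r (offF_mono w S b F hF) (offF_nonneg w S b F hF) hr hcompat
  rw [← hμ, setIntegral_offF_reach w S b F hF x, ← hμ] at key
  -- lower bound of the left-hand side of (GEN)
  have hlow : (μ.real (openConn s₀ b) + μ.real Q) * μ.real (⋃ s ∈ S, (openConn x s : Set (BondConfig (Fin n)))) ≤
      ∑ a ∈ S, μ.real (openConn x a ∩ ⋂ a' ∈ S.filter (fun a' => r a' < r a), (openConn x a')ᶜ : Set (BondConfig (Fin n))) *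
        ∫ ω, F (openCluster ω a) ∂μ := by
    rw [← AGloc.sum_measureReal_firstRank w S r x hr, ← hμ, Finset.mul_sum]
    refine Finset.sum_le_sum fun a ha => ?_
    rw [hmean a ha, mul_comm]
    exact mul_le_mul_of_nonneg_left (add_le_add (hmin a ha) le_rfl) measureReal_nonneg
  have hpart := measureReal_reach_partition w S b x
  rw [← hμ] at hpart
  linear_combination hlow + key - hpart - μ.real (⋃ s ∈ S, (openConn x s : Set (BondConfig (Fin n)))) * hQ1

end K0Set3

/-- **The registered stub `stub_k0set3_g2` — (K₀-set) for `|S| ≥ 3` — PROVED** (statement verbatim from the skeleton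
`Cruxes/AdditiveGluing/Lines/tieline.lean`; the size hypothesis is not used): for a relay SET `S` with `τ`-minimiser `s₀`,
spectator `c ∉ S`, observer `o`, target `b`,
`μ(c↮S ∩ o↔c)·(G_S − Γ_c) ≤ μ(c↮S)·(G_S − Γ_o)`, `G_S = μ(S↔b) − τ_{s₀}`, `Γ_x = μ(x↮b ∩ x↔S ∩ S↔b)`.
[cite: KozmaNitzan2024, Lemma 4 (p. 9), §5.3 (p. 34), Question 7 (p. 36), Conj. 4 (p. 32)]
[cite: VandenbergHaggstromKahn2005, Thm. 1.3 (p. 6), §1 pp. 7–8 display (10)] -/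
theorem stub_k0set3_g2 : ∀ (n : ℕ) (w : Sym2 (Fin n) → unitInterval) (S : Finset (Fin n)) (o b c s₀ : Fin n), 3 ≤ S.card → s₀ ∈ S → c ∉ S → (∀ s ∈ S, (prodBernoulli w).real (openConn s₀ b) ≤ (prodBernoulli w).real (openConn s b)) → (prodBernoulli w).real ((⋃ s ∈ S, (openConn c s : Set (BondConfig (Fin n))))ᶜ ∩ openConn o c) * ((prodBernoulli w).real (⋃ s ∈ S, (openConn s b : Set (BondConfig (Fin n)))) - (prodBernoulli w).real (openConn s₀ b) - (prodBernoulli w).real ((openConn c b)ᶜ ∩ (⋃ s ∈ S, (openConn c s : Set (BondConfig (Fin n)))) ∩ (⋃ s ∈ S, (openConn s b : Set (BondConfig (Fin n)))))) ≤ (prodBernoulli w).real ((⋃ s ∈ S, (openConn c s : Set (BondConfig (Fin n))))ᶜ) * ((prodBernoulli w).real (⋃ s ∈ S, (openConn s b : Set (BondConfig (Fin n)))) - (prodBernoulli w).real (openConn s₀ b) - (prodBernoulli w).real ((openConn o b)ᶜ ∩ (⋃ s ∈ S, (openConn o s : Set (BondConfig (Fin n)))) ∩ (⋃ s ∈ S,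 (openConn s b : Set (BondConfig (Fin n)))))) :=
  fun _ w S o b c s₀ _ hs₀ hcS hmin => K0Set3.k0set w S o b c s₀ hs₀ hcS hmin


end

end Summit.CriticalPhenomena.PercolationContinuityZ3.Cruxes.AdditiveGluing.TieLine
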